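import Summits.HubbardSuperconductivity.HubbardSuperconductivity.Theses.JosephsonMirror
import Summits.HubbardSuperconductivity.HubbardSuperconductivity.Theorems.JosephsonMirrorJmPairBridgeGenericCoupling
import Summits.HubbardSuperconductivity.HubbardSuperconductivity.Theorems.JosephsonMirrorJmPairBridgeSchurCusp
import Summits.HubbardSuperconductivity.HubbardSuperconductivity.Theorems.BalabanIRBirEveryGroundStatePencil
import HarnessLib

/-!
# Crux `JmPairBridge` (stmt-HubbardSuperconductivity-2226), line `schur-rigid-bridge`:
# selection of a generic coupling — the crux from the line's two residues (sorry-free)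

Route `JosephsonMirror`, crux `JmPairBridge` (thesis X). With the propagation theorem of
`Theorems/JosephsonMirrorJmPairBridgeGenericCoupling.lean` (`reducibleFloorPropagates`), the tree's pencil selection
(`exists_coupling_forall_card_roots_le_hubbardTorus`: every coupling window contains a coupling at which, for EVERY
torus side at once, the number of distinct eigenvalues of `hubbardTorus 2 L 1 U` is maximal) and the landed Schur
transfer of line `Sketch` (`everyFromSome_torus`, `exists_symmetryFamily_of_spaceGroup_irreducible`):

* `irreducible_of_generic_of_dense` — density of space-group-irreducible couplings forces irreducibility of the
  `(N_L, 0)` floor at every non-exceptional coupling;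
* `jmPairBridge_of_someBridgeWindow_of_dense` — the crux BY NAME from the two residues of the line: the some-pair
  bridge on an open coupling window (`stub_someBridgeWindow`) and dense space-group irreducibility of the
  `(N_L, 0)` floor for large even sides (`stub_irreducibleFloorDense`, the spectral hypothesis replacing
  `JmCusp (ii)` simplicity: symmetry-enforced multiplets allowed, only SYSTEMATIC accidental degeneracy excluded);
* `irreducible_of_generic_of_denseOn`, `jmPairBridge_of_someBridgeWindow_of_denseOn` — the same with the density
  residue in its weaker WINDOW-RELATIVE form (density of irreducible couplings asked only inside a bridged window;
  the form used by the lead skeleton);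
* `someBridgeWindow_of_interchange_of_cuspWindow`, `jmPairBridge_of_interchange_of_cuspWindow_of_dense` — the window
  residue is exactly what the route's crux `JmInterchange` (stmt-2227) produces from a WINDOW form of `JmCusp (i)`
  (pure logic), so the line reads `JmInterchange → JmCusp(i)-on-a-window → dense irreducibility → JmPairBridge`.

What remains of the crux after this file is exactly the two residues (the open stubs `stub_someBridgeWindow`,
`stub_irreducibleFloorDense` of `Cruxes/JmPairBridge/Lines/schur_rigid_bridge.lean`).

Sources: T. Kato, *Perturbation Theory for Linear Operators* (1966), Ch. II §1.1; J.-P. Serre, *Linear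
Representations of Finite Groups* §2.2; T. Koma, H. Tasaki, J. Stat. Phys. 76 (1994) 745, §3.4. No definition,
no named fact.
-/

noncomputable section

-- the mandated namespace `Summit.<Summit>.<Problem>.Theorems` repeats `HubbardSuperconductivity`
-- (single-problem summit, D-0017), which the `dupNamespace` linter flags on every declaration
set_option linter.dupNamespace false

namespace Summit.HubbardSuperconductivity.HubbardSuperconductivity.Theorems.JosephsonMirror

open Matrix Literature.MathematicalPhysics.QuantumLattice Literature.Probability.LatticeModels
open Summit.HubbardSuperconductivity.HubbardSuperconductivity.Theses.JosephsonMirror (JmPairBridge JmInterchange)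
open scoped ComplexOrder

/-- **Irreducibility at non-exceptional couplings** (conditional on the density residue `hdense` =
`stub_irreducibleFloorDense`): for every `δ ∈ (0, 1/2)`, for all large even `L`, at every coupling `U > 0`
where the number of distinct eigenvalues of `hubbardTorus 2 L 1 U` is maximal, the `(N_L, 0)` ground floor is
irreducible under the space group (density of irreducible couplings + openness of reducibility near `U`,
`reducibleFloorPropagates`). [folklore] -/
theorem irreducible_of_generic_of_dense
    (hdense : (∀ δ ∈ Set.Ioo (0:ℝ) (1 / 2), ∃ L₁ : ℕ, ∀ (L : ℕ) [NeZero L], Even L → L₁ ≤ L →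
        ∀ U₁ U₂ : ℝ, 0 < U₁ → U₁ < U₂ → ∃ U ∈ Set.Ioo U₁ U₂,
          ∀ K' : Submodule ℂ (Fock (Orb (FermionTorus 2 L))),
            K' ≤ szSector (2 * ⌊(1 - δ) * (L : ℝ) ^ 2 / 2⌋₊) 0 ⊓
                Module.End.eigenspace (Matrix.toLin' (hubbardTorus 2 L 1 U))
                  (((hubbardTorus 2 L 1 U).minEnergyOn (szSector (2 * ⌊(1 - δ) * (L : ℝ) ^ 2 / 2⌋₊) 0) : ℝ) : ℂ) →
            (∀ (γ : DihedralGroup 4) (v : TorusSite 2 L), ∀ w ∈ K',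
              ((fockD4 γ).val * (fockTranslate v).val) *ᵥ w ∈ K') →
            K' = ⊥ ∨ K' = szSector (2 * ⌊(1 - δ) * (L : ℝ) ^ 2 / 2⌋₊) 0 ⊓
                Module.End.eigenspace (Matrix.toLin' (hubbardTorus 2 L 1 U))
                  (((hubbardTorus 2 L 1 U).minEnergyOn (szSector (2 * ⌊(1 - δ) * (L : ℝ) ^ 2 / 2⌋₊) 0) : ℝ) : ℂ)))
    (δ : ℝ) (hδ : δ ∈ Set.Ioo (0:ℝ) (1 / 2)) :
    ∃ L₁ : ℕ, ∀ (L : ℕ) [NeZero L], Even L → L₁ ≤ L → ∀ U : ℝ, 0 < U →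
      (∀ u' : ℝ, (hubbardTorus 2 L 1 u').charpoly.roots.toFinset.card ≤
        (hubbardTorus 2 L 1 U).charpoly.roots.toFinset.card) →
      ∀ K' : Submodule ℂ (Fock (Orb (FermionTorus 2 L))),
        K' ≤ szSector (2 * ⌊(1 - δ) * (L : ℝ) ^ 2 / 2⌋₊) 0 ⊓
            Module.End.eigenspace (Matrix.toLin' (hubbardTorus 2 L 1 U))
              (((hubbardTorus 2 L 1 U).minEnergyOn (szSector (2 * ⌊(1 - δ) * (L : ℝ) ^ 2 / 2⌋₊) 0) : ℝ) : ℂ) →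
        (∀ (γ : DihedralGroup 4) (v : TorusSite 2 L), ∀ w ∈ K',
          ((fockD4 γ).val * (fockTranslate v).val) *ᵥ w ∈ K') →
        K' = ⊥ ∨ K' = szSector (2 * ⌊(1 - δ) * (L : ℝ) ^ 2 / 2⌋₊) 0 ⊓
            Module.End.eigenspace (Matrix.toLin' (hubbardTorus 2 L 1 U))
              (((hubbardTorus 2 L 1 U).minEnergyOn (szSector (2 * ⌊(1 - δ) * (L : ℝ) ^ 2 / 2⌋₊) 0) : ℝ) : ℂ) := by
  obtain ⟨L₁, hL₁⟩ := hdense δ hδ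
  refine ⟨L₁, fun L _ hE hL U hU hgen => ?_⟩
  by_contra hred
  obtain ⟨ε, hε, hbad⟩ := reducibleFloorPropagates L _ U hgen hred
  obtain ⟨U', hU', hirr'⟩ := hL₁ L hE hL (max (U - ε / 2) (U / 2)) (U + ε / 2)
    (lt_max_of_lt_right (half_pos hU)) (max_lt (by linarith) (by linarith))
  have h1 : U - ε / 2 < U' := lt_of_le_of_lt (le_max_left _ _) hU'.1
  exact hbad U' ⟨by linarith, by linarith [hU'.2]⟩ hirr'

/-- **The crux from the two residues of line `schur-rigid-bridge`** (sorry-free CONDITIONAL landing of the line):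
the window some-pair bridge `hwin` (= `stub_someBridgeWindow`, the window form of `JmInterchange ∘ JmCusp (i)`) and
dense space-group irreducibility of the `(N_L, 0)` floor for large even sides `hdense` (= `stub_irreducibleFloorDense`)
prove `JmPairBridge`. The window residue gives `(δ, U₁, U₂)`; a coupling `U⋆ ∈ (U₁, U₂)` non-exceptional for EVERY torus
side is selected (`exists_coupling_forall_card_roots_le_hubbardTorus`); at `U⋆` the some-pair bridge holds
eventually with some `a > 0`, the `(N_L, 0)` floor is eventually space-group irreducible
(`irreducible_of_generic_of_dense`), and the landed Schur transfer (`everyFromSome_torus` with the space-group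
family, `exists_symmetryFamily_of_spaceGroup_irreducible`) bridges EVERY unit ground state. [folklore] -/
theorem jmPairBridge_of_someBridgeWindow_of_dense
    (hwin : (∃ δ ∈ Set.Ioo (0:ℝ) (1 / 2), ∃ U₁ U₂ : ℝ, 0 < U₁ ∧ U₁ < U₂ ∧ ∀ U ∈ Set.Ioo U₁ U₂,
        ∃ a : ℝ, 0 < a ∧ ∃ L₀ : ℕ, ∀ (L : ℕ) [NeZero L], Even L → L₀ ≤ L →
          ∃ φ₀ χ₀ : Fock (Orb (FermionTorus 2 L)),
            IsGroundStateInSector (hubbardTorus 2 L 1 U) (2 * ⌊(1 - δ) * (L : ℝ) ^ 2 / 2⌋₊) 0 φ₀ ∧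
            star φ₀ ⬝ᵥ φ₀ = 1 ∧
            IsGroundStateInSector (hubbardTorus 2 L 1 U) (2 * ⌊(1 - δ) * (L : ℝ) ^ 2 / 2⌋₊ - 2) 0 χ₀ ∧
            star χ₀ ⬝ᵥ χ₀ = 1 ∧
            a * (L : ℝ) ^ 4 ≤ ‖star χ₀ ⬝ᵥ Matrix.mulVec (pairField dWaveFormFactor L) φ₀‖ ^ 2))
    (hdense : (∀ δ ∈ Set.Ioo (0:ℝ) (1 / 2), ∃ L₁ : ℕ, ∀ (L : ℕ) [NeZero L], Even L → L₁ ≤ L →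
        ∀ U₁ U₂ : ℝ, 0 < U₁ → U₁ < U₂ → ∃ U ∈ Set.Ioo U₁ U₂,
          ∀ K' : Submodule ℂ (Fock (Orb (FermionTorus 2 L))),
            K' ≤ szSector (2 * ⌊(1 - δ) * (L : ℝ) ^ 2 / 2⌋₊) 0 ⊓
                Module.End.eigenspace (Matrix.toLin' (hubbardTorus 2 L 1 U))
                  (((hubbardTorus 2 L 1 U).minEnergyOn (szSector (2 * ⌊(1 - δ) * (L : ℝ) ^ 2 / 2⌋₊) 0) : ℝ) : ℂ) →
            (∀ (γ : DihedralGroup 4) (v : TorusSite 2 L), ∀ w ∈ K',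
              ((fockD4 γ).val * (fockTranslate v).val) *ᵥ w ∈ K') →
            K' = ⊥ ∨ K' = szSector (2 * ⌊(1 - δ) * (L : ℝ) ^ 2 / 2⌋₊) 0 ⊓
                Module.End.eigenspace (Matrix.toLin' (hubbardTorus 2 L 1 U))
                  (((hubbardTorus 2 L 1 U).minEnergyOn (szSector (2 * ⌊(1 - δ) * (L : ℝ) ^ 2 / 2⌋₊) 0) : ℝ) : ℂ))) :
    JmPairBridge := by
  unfold JmPairBridge
  obtain ⟨δ, hδ, U₁, U₂, hU₁, hU₁₂, hwin⟩ := hwin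
  obtain ⟨U, hU, hgenU⟩ := exists_coupling_forall_card_roots_le_hubbardTorus hU₁₂
  obtain ⟨a, ha, L₀, hsome⟩ := hwin U hU
  obtain ⟨L₁, hirr⟩ := irreducible_of_generic_of_dense hdense δ hδ
  have hUpos : 0 < U := hU₁.trans hU.1
  refine ⟨U, hUpos, δ, hδ, a, ha, max L₀ L₁, fun L _ hE hL φ hφ hφ1 => ?_⟩
  obtain ⟨S, hS, hSirr⟩ := exists_symmetryFamily_of_spaceGroup_irreducible U
    (2 * ⌊(1 - δ) * (L : ℝ) ^ 2 / 2⌋₊) _ (hirr L hE (le_of_max_le_right hL) U hUpos (hgenU L))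
  exact everyFromSome_torus L U _ _ S hS hSirr (hsome L hE (le_of_max_le_left hL)) φ hφ hφ1


/-! ## The window-relative form of the density residue (weaker: density is asked only inside a bridged window) -/

/-- **Irreducibility at non-exceptional couplings of a window**, from density of irreducible couplings INSIDE
that window only: if for all large even `L` every sub-window of `[U₁, U₂]` contains a coupling with a
space-group-irreducible `(N_L, 0)` floor, then for all large even `L` the floor is irreducible at every
non-exceptional coupling of `(U₁, U₂)` (`reducibleFloorPropagates`). [folklore] -/
theorem irreducible_of_generic_of_denseOn (δ : ℝ) (U₁ U₂ : ℝ)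
    (hdense : ∃ L₁ : ℕ, ∀ (L : ℕ) [NeZero L], Even L → L₁ ≤ L →
      ∀ V₁ V₂ : ℝ, U₁ ≤ V₁ → V₁ < V₂ → V₂ ≤ U₂ → ∃ U ∈ Set.Ioo V₁ V₂,
        ∀ K' : Submodule ℂ (Fock (Orb (FermionTorus 2 L))),
          K' ≤ szSector (2 * ⌊(1 - δ) * (L : ℝ) ^ 2 / 2⌋₊) 0 ⊓
              Module.End.eigenspace (Matrix.toLin' (hubbardTorus 2 L 1 U))
                (((hubbardTorus 2 L 1 U).minEnergyOn (szSector (2 * ⌊(1 - δ) * (L : ℝ) ^ 2 / 2⌋₊) 0) : ℝ) : ℂ) →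
          (∀ (γ : DihedralGroup 4) (v : TorusSite 2 L), ∀ w ∈ K',
            ((fockD4 γ).val * (fockTranslate v).val) *ᵥ w ∈ K') →
          K' = ⊥ ∨ K' = szSector (2 * ⌊(1 - δ) * (L : ℝ) ^ 2 / 2⌋₊) 0 ⊓
              Module.End.eigenspace (Matrix.toLin' (hubbardTorus 2 L 1 U))
                (((hubbardTorus 2 L 1 U).minEnergyOn (szSector (2 * ⌊(1 - δ) * (L : ℝ) ^ 2 / 2⌋₊) 0) : ℝ) : ℂ)) :
    ∃ L₁ : ℕ, ∀ (L : ℕ) [NeZero L], Even L → L₁ ≤ L → ∀ U ∈ Set.Ioo U₁ U₂,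
      (∀ u' : ℝ, (hubbardTorus 2 L 1 u').charpoly.roots.toFinset.card ≤
        (hubbardTorus 2 L 1 U).charpoly.roots.toFinset.card) →
      ∀ K' : Submodule ℂ (Fock (Orb (FermionTorus 2 L))),
        K' ≤ szSector (2 * ⌊(1 - δ) * (L : ℝ) ^ 2 / 2⌋₊) 0 ⊓
            Module.End.eigenspace (Matrix.toLin' (hubbardTorus 2 L 1 U))
              (((hubbardTorus 2 L 1 U).minEnergyOn (szSector (2 * ⌊(1 - δ) * (L : ℝ) ^ 2 / 2⌋₊) 0) : ℝ) : ℂ) →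
        (∀ (γ : DihedralGroup 4) (v : TorusSite 2 L), ∀ w ∈ K',
          ((fockD4 γ).val * (fockTranslate v).val) *ᵥ w ∈ K') →
        K' = ⊥ ∨ K' = szSector (2 * ⌊(1 - δ) * (L : ℝ) ^ 2 / 2⌋₊) 0 ⊓
            Module.End.eigenspace (Matrix.toLin' (hubbardTorus 2 L 1 U))
              (((hubbardTorus 2 L 1 U).minEnergyOn (szSector (2 * ⌊(1 - δ) * (L : ℝ) ^ 2 / 2⌋₊) 0) : ℝ) : ℂ) := by
  obtain ⟨L₁, hL₁⟩ := hdense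
  refine ⟨L₁, fun L _ hE hL U hU hgen => ?_⟩
  by_contra hred
  obtain ⟨ε, hε, hbad⟩ := reducibleFloorPropagates L _ U hgen hred
  obtain ⟨U', hU', hirr'⟩ := hL₁ L hE hL (max (U - ε / 2) U₁) (min (U + ε / 2) U₂) (le_max_right _ _)
    (max_lt (lt_min (by linarith) (by linarith [hU.2])) (lt_min (by linarith [hU.1]) (hU.1.trans hU.2)))
    (min_le_right _ _)
  have h1 : U - ε / 2 < U' := lt_of_le_of_lt (le_max_left _ _) hU'.1
  have h2 : U' < U + ε / 2 := lt_of_lt_of_le hU'.2 (min_le_left _ _)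
  exact hbad U' ⟨by linarith, by linarith⟩ hirr'

/-- **The crux from the window some-pair bridge and WINDOW-RELATIVE dense irreducibility** (the weakest residue
pair of line `schur-rigid-bridge`, the form used by the lead skeleton): `hwin` = `stub_someBridgeWindow`;
`hdense` = `stub_irreducibleFloorDense` in its window-relative form — IF the some-pair bridge holds at every
coupling of a window, THEN for all large even `L` the couplings of that window with a space-group-irreducible
`(N_L, 0)` floor are dense in it. A coupling of the window non-exceptional for every torus side
(`exists_coupling_forall_card_roots_le_hubbardTorus`) then carries both the bridge and, eventually, an
irreducible floor, and the landed Schur transfer bridges every unit ground state. [folklore] -/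
theorem jmPairBridge_of_someBridgeWindow_of_denseOn
    (hwin : (∃ δ ∈ Set.Ioo (0:ℝ) (1 / 2), ∃ U₁ U₂ : ℝ, 0 < U₁ ∧ U₁ < U₂ ∧ ∀ U ∈ Set.Ioo U₁ U₂,
      ∃ a : ℝ, 0 < a ∧ ∃ L₀ : ℕ, ∀ (L : ℕ) [NeZero L], Even L → L₀ ≤ L →
        ∃ φ₀ χ₀ : Fock (Orb (FermionTorus 2 L)),
          IsGroundStateInSector (hubbardTorus 2 L 1 U) (2 * ⌊(1 - δ) * (L : ℝ) ^ 2 / 2⌋₊) 0 φ₀ ∧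
          star φ₀ ⬝ᵥ φ₀ = 1 ∧
          IsGroundStateInSector (hubbardTorus 2 L 1 U) (2 * ⌊(1 - δ) * (L : ℝ) ^ 2 / 2⌋₊ - 2) 0 χ₀ ∧
          star χ₀ ⬝ᵥ χ₀ = 1 ∧
          a * (L : ℝ) ^ 4 ≤ ‖star χ₀ ⬝ᵥ Matrix.mulVec (pairField dWaveFormFactor L) φ₀‖ ^ 2))
    (hdense : (∀ δ ∈ Set.Ioo (0:ℝ) (1 / 2), ∀ U₁ U₂ : ℝ, 0 < U₁ → U₁ < U₂ →
      (∀ U ∈ Set.Ioo U₁ U₂, ∃ a : ℝ, 0 < a ∧ ∃ L₀ : ℕ, ∀ (L : ℕ) [NeZero L], Even L → L₀ ≤ L →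
        ∃ φ₀ χ₀ : Fock (Orb (FermionTorus 2 L)),
          IsGroundStateInSector (hubbardTorus 2 L 1 U) (2 * ⌊(1 - δ) * (L : ℝ) ^ 2 / 2⌋₊) 0 φ₀ ∧
          star φ₀ ⬝ᵥ φ₀ = 1 ∧
          IsGroundStateInSector (hubbardTorus 2 L 1 U) (2 * ⌊(1 - δ) * (L : ℝ) ^ 2 / 2⌋₊ - 2) 0 χ₀ ∧
          star χ₀ ⬝ᵥ χ₀ = 1 ∧
          a * (L : ℝ) ^ 4 ≤ ‖star χ₀ ⬝ᵥ Matrix.mulVec (pairField dWaveFormFactor L) φ₀‖ ^ 2) →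
      ∃ L₁ : ℕ, ∀ (L : ℕ) [NeZero L], Even L → L₁ ≤ L →
        ∀ V₁ V₂ : ℝ, U₁ ≤ V₁ → V₁ < V₂ → V₂ ≤ U₂ → ∃ U ∈ Set.Ioo V₁ V₂,
        ∀ K' : Submodule ℂ (Fock (Orb (FermionTorus 2 L))),
          K' ≤ szSector (2 * ⌊(1 - δ) * (L : ℝ) ^ 2 / 2⌋₊) 0 ⊓
              Module.End.eigenspace (Matrix.toLin' (hubbardTorus 2 L 1 U))
                (((hubbardTorus 2 L 1 U).minEnergyOn (szSector (2 * ⌊(1 - δ) * (L : ℝ) ^ 2 / 2⌋₊) 0) : ℝ) : ℂ) →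
          (∀ (γ : DihedralGroup 4) (v : TorusSite 2 L), ∀ w ∈ K',
            ((fockD4 γ).val * (fockTranslate v).val) *ᵥ w ∈ K') →
          K' = ⊥ ∨ K' = szSector (2 * ⌊(1 - δ) * (L : ℝ) ^ 2 / 2⌋₊) 0 ⊓
              Module.End.eigenspace (Matrix.toLin' (hubbardTorus 2 L 1 U))
                (((hubbardTorus 2 L 1 U).minEnergyOn (szSector (2 * ⌊(1 - δ) * (L : ℝ) ^ 2 / 2⌋₊) 0) : ℝ) : ℂ))) :
    JmPairBridge := by
  unfold JmPairBridge
  obtain ⟨δ, hδ, U₁, U₂, hU₁, hU₁₂, hwin⟩ := hwin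
  obtain ⟨U, hU, hgenU⟩ := exists_coupling_forall_card_roots_le_hubbardTorus hU₁₂
  obtain ⟨a, ha, L₀, hsome⟩ := hwin U hU
  obtain ⟨L₁, hirr⟩ := irreducible_of_generic_of_denseOn δ U₁ U₂ (hdense δ hδ U₁ U₂ hU₁ hU₁₂ hwin)
  have hUpos : 0 < U := hU₁.trans hU.1
  refine ⟨U, hUpos, δ, hδ, a, ha, max L₀ L₁, fun L _ hE hL φ hφ hφ1 => ?_⟩
  obtain ⟨S, hS, hSirr⟩ := exists_symmetryFamily_of_spaceGroup_irreducible U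
    (2 * ⌊(1 - δ) * (L : ℝ) ^ 2 / 2⌋₊) _ (hirr L hE (le_of_max_le_right hL) U hU (hgenU L))
  exact everyFromSome_torus L U _ _ S hS hSirr (hsome L hE (le_of_max_le_left hL)) φ hφ hφ1


/-! ## The window residue from the route's own cruxes (pure logic; the restatement target for the planner) -/

/-- **The window some-pair bridge from `JmInterchange` and a WINDOW form of `JmCusp (i)`.** If the uniform
linear Josephson gain of the window double holds at every coupling of an open window `(U₁, U₂)` (with the
same `δ`; constants `a`, `J₀` may depend on `U`), then crux `JmInterchange` (stmt-2227) yields the window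
some-pair bridge `stub_someBridgeWindow` of line `schur-rigid-bridge`. Koma–Tasaki (1994) §3.4. [folklore] -/
theorem someBridgeWindow_of_interchange_of_cuspWindow (hI : JmInterchange)
    (hW : (∃ δ ∈ Set.Ioo (0:ℝ) (1 / 2), ∃ U₁ U₂ : ℝ, 0 < U₁ ∧ U₁ < U₂ ∧ ∀ U ∈ Set.Ioo U₁ U₂,
      ∃ a : ℝ, 0 < a ∧ ∃ J₀ : ℝ, 0 < J₀ ∧
      (∀ J ∈ Set.Ioc (0:ℝ) J₀, ∃ L₀ : ℕ, ∀ (L : ℕ) [NeZero L], Even L → L₀ ≤ L →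
        (let ι : Type := Finset (Orb (FermionTorus 2 L))
         let N : ℕ := 2 * ⌊(1 - δ) * (L : ℝ) ^ 2 / 2⌋₊
         let H : Matrix ι ι ℂ := hubbardTorus 2 L 1 U
         let μ : ℝ := (H.minEnergyOn (szSector N 0) - H.minEnergyOn (szSector (N - 2) 0)) / 2
         let A : Matrix ι ι ℂ := hubbardTorusWith 2 L 1 U μ
         let D : Matrix ι ι ℂ := ((L : ℂ))⁻¹ • pairField dWaveFormFactor L
         let Hd : ℝ → Matrix (ι × ι) (ι × ι) ℂ := fun J =>
           Matrix.kroneckerMap (fun a b : ℂ => a * b) A 1 +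
             Matrix.kroneckerMap (fun a b : ℂ => a * b) 1 (Matrix.transpose A) -
             (J : ℂ) • (Matrix.kroneckerMap (fun a b : ℂ => a * b) D
                 (Matrix.transpose (Matrix.conjTranspose D)) +
               Matrix.kroneckerMap (fun a b : ℂ => a * b) (Matrix.conjTranspose D) (Matrix.transpose D))
         let good : ι × ι → Prop := fun p =>
           ((p.1.card = N ∧ p.2.card = N) ∨ (p.1.card = N - 2 ∧ p.2.card = N - 2)) ∧
             (p.1.filter (fun o => (ofLex o).2 = 0)).card = (p.1.filter (fun o => (ofLex o).2 = 1)).card ∧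
             (p.2.filter (fun o => (ofLex o).2 = 0)).card = (p.2.filter (fun o => (ofLex o).2 = 1)).card
         let S : Submodule ℂ (ι × ι → ℂ) :=
           ⨅ (p : ι × ι) (_ : ¬ good p), LinearMap.ker (LinearMap.proj (R := ℂ) (φ := fun _ : ι × ι => ℂ) p)
         let E : ℝ → ℝ := fun J => (Hd J).minEnergyOn S
         a * J * (L : ℝ) ^ 2 ≤ E 0 - E J)))) :
    ∃ δ ∈ Set.Ioo (0:ℝ) (1 / 2), ∃ U₁ U₂ : ℝ, 0 < U₁ ∧ U₁ < U₂ ∧ ∀ U ∈ Set.Ioo U₁ U₂,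
      ∃ a : ℝ, 0 < a ∧ ∃ L₀ : ℕ, ∀ (L : ℕ) [NeZero L], Even L → L₀ ≤ L →
        ∃ φ₀ χ₀ : Fock (Orb (FermionTorus 2 L)),
          IsGroundStateInSector (hubbardTorus 2 L 1 U) (2 * ⌊(1 - δ) * (L : ℝ) ^ 2 / 2⌋₊) 0 φ₀ ∧
          star φ₀ ⬝ᵥ φ₀ = 1 ∧
          IsGroundStateInSector (hubbardTorus 2 L 1 U) (2 * ⌊(1 - δ) * (L : ℝ) ^ 2 / 2⌋₊ - 2) 0 χ₀ ∧
          star χ₀ ⬝ᵥ χ₀ = 1 ∧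
          a * (L : ℝ) ^ 4 ≤ ‖star χ₀ ⬝ᵥ Matrix.mulVec (pairField dWaveFormFactor L) φ₀‖ ^ 2 := by
  obtain ⟨δ, hδ, U₁, U₂, hU₁, hU₁₂, hgain⟩ := hW
  refine ⟨δ, hδ, U₁, U₂, hU₁, hU₁₂, fun U hU => ?_⟩
  obtain ⟨a, ha, J₀, hJ₀, hg⟩ := hgain U hU
  obtain ⟨a', ha', L₀, hb⟩ := hI U δ a J₀ (hU₁.trans hU.1) hδ ha hJ₀ hg
  exact ⟨a', ha', L₀, fun L _ hE hL => hb L hE hL⟩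

/-- **The crux from `JmInterchange`, a window form of `JmCusp (i)` and dense irreducibility** — the whole line
`schur-rigid-bridge` as ONE sorry-free implication from route decls and the spectral residue: the recommended
restatement of the bet `JmCusp` for the tenure planner is "(i) on an open coupling window" + "(ii) replaced by
dense space-group irreducibility of the `(N_L, 0)` floor for large even sides". [folklore] -/
theorem jmPairBridge_of_interchange_of_cuspWindow_of_dense (hI : JmInterchange)
    (hW : (∃ δ ∈ Set.Ioo (0:ℝ) (1 / 2), ∃ U₁ U₂ : ℝ, 0 < U₁ ∧ U₁ < U₂ ∧ ∀ U ∈ Set.Ioo U₁ U₂,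
      ∃ a : ℝ, 0 < a ∧ ∃ J₀ : ℝ, 0 < J₀ ∧
      (∀ J ∈ Set.Ioc (0:ℝ) J₀, ∃ L₀ : ℕ, ∀ (L : ℕ) [NeZero L], Even L → L₀ ≤ L →
        (let ι : Type := Finset (Orb (FermionTorus 2 L))
         let N : ℕ := 2 * ⌊(1 - δ) * (L : ℝ) ^ 2 / 2⌋₊
         let H : Matrix ι ι ℂ := hubbardTorus 2 L 1 U
         let μ : ℝ := (H.minEnergyOn (szSector N 0) - H.minEnergyOn (szSector (N - 2) 0)) / 2
         let A : Matrix ι ι ℂ := hubbardTorusWith 2 L 1 U μ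
         let D : Matrix ι ι ℂ := ((L : ℂ))⁻¹ • pairField dWaveFormFactor L
         let Hd : ℝ → Matrix (ι × ι) (ι × ι) ℂ := fun J =>
           Matrix.kroneckerMap (fun a b : ℂ => a * b) A 1 +
             Matrix.kroneckerMap (fun a b : ℂ => a * b) 1 (Matrix.transpose A) -
             (J : ℂ) • (Matrix.kroneckerMap (fun a b : ℂ => a * b) D
                 (Matrix.transpose (Matrix.conjTranspose D)) +
               Matrix.kroneckerMap (fun a b : ℂ => a * b) (Matrix.conjTranspose D) (Matrix.transpose D))
         let good : ι × ι → Prop := fun p =>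
           ((p.1.card = N ∧ p.2.card = N) ∨ (p.1.card = N - 2 ∧ p.2.card = N - 2)) ∧
             (p.1.filter (fun o => (ofLex o).2 = 0)).card = (p.1.filter (fun o => (ofLex o).2 = 1)).card ∧
             (p.2.filter (fun o => (ofLex o).2 = 0)).card = (p.2.filter (fun o => (ofLex o).2 = 1)).card
         let S : Submodule ℂ (ι × ι → ℂ) :=
           ⨅ (p : ι × ι) (_ : ¬ good p), LinearMap.ker (LinearMap.proj (R := ℂ) (φ := fun _ : ι × ι => ℂ) p)
         let E : ℝ → ℝ := fun J => (Hd J).minEnergyOn S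
         a * J * (L : ℝ) ^ 2 ≤ E 0 - E J))))
    (hdense : (∀ δ ∈ Set.Ioo (0:ℝ) (1 / 2), ∃ L₁ : ℕ, ∀ (L : ℕ) [NeZero L], Even L → L₁ ≤ L →
        ∀ U₁ U₂ : ℝ, 0 < U₁ → U₁ < U₂ → ∃ U ∈ Set.Ioo U₁ U₂,
          ∀ K' : Submodule ℂ (Fock (Orb (FermionTorus 2 L))),
            K' ≤ szSector (2 * ⌊(1 - δ) * (L : ℝ) ^ 2 / 2⌋₊) 0 ⊓
                Module.End.eigenspace (Matrix.toLin' (hubbardTorus 2 L 1 U))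
                  (((hubbardTorus 2 L 1 U).minEnergyOn (szSector (2 * ⌊(1 - δ) * (L : ℝ) ^ 2 / 2⌋₊) 0) : ℝ) : ℂ) →
            (∀ (γ : DihedralGroup 4) (v : TorusSite 2 L), ∀ w ∈ K',
              ((fockD4 γ).val * (fockTranslate v).val) *ᵥ w ∈ K') →
            K' = ⊥ ∨ K' = szSector (2 * ⌊(1 - δ) * (L : ℝ) ^ 2 / 2⌋₊) 0 ⊓
                Module.End.eigenspace (Matrix.toLin' (hubbardTorus 2 L 1 U))
                  (((hubbardTorus 2 L 1 U).minEnergyOn (szSector (2 * ⌊(1 - δ) * (L : ℝ) ^ 2 / 2⌋₊) 0) : ℝ) : ℂ))) :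
    JmPairBridge :=
  jmPairBridge_of_someBridgeWindow_of_dense (someBridgeWindow_of_interchange_of_cuspWindow hI hW) hdense

end Summit.HubbardSuperconductivity.HubbardSuperconductivity.Theorems.JosephsonMirror

end
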